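import Mathlib.Topology.NhdsSet
import Mathlib.Order.Basic
import HarnessLib

/-!
# Inductive constructions over an exhaustion (locally eventually constant limits)

Topic `Literature/Topology`; general infrastructure. The standard device by which a solution
of a *local* problem on a non-compact space is assembled from solutions on the pieces of an
exhaustion `K₀ ⊆ K₁ ⊆ ⋯`, `⋃ⱼ interior Kⱼ = X`: if a solution "good at stage `j`" can always be
improved to one "good at stage `j + 1`" **without changing it on `Kⱼ`**, then the sequence of
successive improvements is eventually constant near every point, and its pointwise limit
enjoys, at each point, every germ-determined property the stages enjoy there.

This is the existence-only content of the last step of Phillips' proof of his Theorem A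
(*Submersions of open manifolds*, 1967, pp. 194–195: "`Sub M` … [is] the inverse limit of the
system (`Sub Uⱼ`, `pₖⱼ`) … Lemma 2 of Appendix I"), and the shape of the "inductive
constructions" of the Lean sphere-eversion project (Massot–van Doorn–Nash); it is recorded here
because Mathlib has no such lemma. Everything is **proved**; no definitions, no named facts.

* `Literature.Topology.exists_forall_of_exhaustion` — sets `K : ℕ → Set X`, monotone, whose
  interiors cover `X`; stage predicates `P j` on functions `X → Y` and a target predicate
  `Q x` which is invariant under `=ᶠ[𝓝 x]`; if `P j f` gives `Q x f` on `interior (K j)`, some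
  `f₀` satisfies `P 0`, and every `f` with `P j f` can be replaced by `g` with `P (j+1) g` and
  `g = f` on `K j`, then some `F : X → Y` satisfies `Q x F` at every point.
* `Literature.Topology.exists_seq_forall_eqOn_of_exhaustion` — the same, exhibiting the whole
  sequence of stages `fⱼ` (`P j fⱼ`, `f_{j+1} = fⱼ` on `K j`) and a limit `F` with `F = fⱼ` on
  `K j` for every `j`;
* `Literature.Topology.exists_seq_eqOn`, `Literature.Topology.eqOn_of_forall_eqOn_succ` — the
  dependent choice of the stages and their agreement `f_k = fⱼ` on `K j` for `k ≥ j`.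

## References

* A. Phillips, *Submersions of open manifolds*, Topology **6** (1967), 171–206, proof of Thm. A,
  pp. 194–195. [Phillips1967]
-/

open Set Filter Topology

namespace Literature.Topology

variable {X Y : Type*}

/-- **The sequence of stages.** From a base function with `P 0` and a step producing, from any
`f` with `P j f`, some `g` with `P (j + 1) g` agreeing with `f` on `K j`, dependent choice
gives a sequence `fⱼ` with `P j fⱼ` and `f_{j+1} = fⱼ` on `K j`. [folklore] -/
theorem exists_seq_eqOn (P : ℕ → (X → Y) → Prop) (K : ℕ → Set X) (h0 : ∃ f, P 0 f)
    (hstep : ∀ j f, P j f → ∃ g, P (j + 1) g ∧ EqOn g f (K j)) :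
    ∃ f : ℕ → X → Y, (∀ j, P j (f j)) ∧ ∀ j, EqOn (f (j + 1)) (f j) (K j) := by
  classical
  let f : (j : ℕ) → {f : X → Y // P j f} := fun j =>
    Nat.rec (motive := fun j => {f : X → Y // P j f}) ⟨h0.choose, h0.choose_spec⟩
      (fun j fj => ⟨(hstep j fj.1 fj.2).choose, (hstep j fj.1 fj.2).choose_spec.1⟩) j
  refine ⟨fun j => (f j).1, fun j => (f j).2, fun j => ?_⟩
  exact (hstep j (f j).1 (f j).2).choose_spec.2

/-- Later stages agree with the `j`-th one on `K j` when the sets `K j` increase. [folklore] -/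
theorem eqOn_of_forall_eqOn_succ {K : ℕ → Set X} (hmono : ∀ j, K j ⊆ K (j + 1))
    {f : ℕ → X → Y} (hf : ∀ j, EqOn (f (j + 1)) (f j) (K j)) {j k : ℕ} (hjk : j ≤ k) :
    EqOn (f k) (f j) (K j) := by
  have hK : Monotone K := monotone_nat_of_le_succ hmono
  induction hjk with
  | refl => exact fun _ _ => rfl
  | @step k hjk ih =>
    intro x hx
    rw [hf k (hK hjk hx)]
    exact ih hx

section

variable [TopologicalSpace X]

/-- **Inductive construction over an exhaustion.** Let `K : ℕ → Set X` be increasing with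
`⋃ⱼ interior (K j) = X`. Let `P j` ("good at stage `j`") be predicates on functions `X → Y` and
`Q x` a property of functions which depends only on the germ at `x`. Assume: a function good
at stage `j` has property `Q` at every point of `interior (K j)`; some function is good at
stage `0`; and every function `f` good at stage `j` can be replaced by one good at stage
`j + 1` which agrees with `f` on `K j`. Then there is `F : X → Y` with `Q x F` for all `x`:
the successive replacements `fⱼ` agree with `fⱼ₀` on `K j₀` for `j ≥ j₀`, so
`F x := f_{j(x)} x` (any `j(x)` with `x ∈ interior K_{j(x)}`) coincides with `fⱼ₀` on the
neighbourhood `interior (K j₀)` of any of its points. This is the existence part of the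
inverse-limit step in Phillips' proof of Theorem A. [cite: Phillips1967, proof of Thm. A, pp. 194–195] -/
theorem exists_forall_of_exhaustion (K : ℕ → Set X) (hmono : ∀ j, K j ⊆ K (j + 1))
    (hcov : ∀ x, ∃ j, x ∈ interior (K j)) (P : ℕ → (X → Y) → Prop) (Q : X → (X → Y) → Prop)
    (hQ : ∀ x (f g : X → Y), f =ᶠ[𝓝 x] g → Q x f → Q x g)
    (hPQ : ∀ j f, P j f → ∀ x ∈ interior (K j), Q x f) (h0 : ∃ f, P 0 f)
    (hstep : ∀ j f, P j f → ∃ g, P (j + 1) g ∧ EqOn g f (K j)) :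
    ∃ F : X → Y, ∀ x, Q x F := by
  classical
  obtain ⟨f, hP, hf⟩ := exists_seq_eqOn P K h0 hstep
  choose J hJ using hcov
  refine ⟨fun x => f (J x) x, fun x₀ => ?_⟩
  -- near `x₀`, `F` coincides with the stage `J x₀`
  refine hQ x₀ (f (J x₀)) _ ?_ (hPQ (J x₀) (f (J x₀)) (hP (J x₀)) x₀ (hJ x₀))
  filter_upwards [isOpen_interior.mem_nhds (hJ x₀)] with y hy
  have hy₀ : y ∈ K (J x₀) := interior_subset hy
  have hy₁ : y ∈ K (J y) := interior_subset (hJ y)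
  -- both `f (J x₀) y` and `f (J y) y` are the value at `y` of the stage `max (J x₀) (J y)`
  rw [← eqOn_of_forall_eqOn_succ hmono hf (le_max_left (J x₀) (J y)) hy₀,
    ← eqOn_of_forall_eqOn_succ hmono hf (le_max_right (J x₀) (J y)) hy₁]

/-- **Inductive construction over an exhaustion, with the stages.** Same as
`exists_forall_of_exhaustion`, but exhibiting a sequence of stages `f j` with `P j (f j)`,
`f (j+1) = f j` on `K j`, and a limit `F` which agrees with `f j` on `K j` for every `j`.
[cite: Phillips1967, proof of Thm. A, pp. 194–195] -/
theorem exists_seq_forall_eqOn_of_exhaustion (K : ℕ → Set X) (hmono : ∀ j, K j ⊆ K (j + 1))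
    (hcov : ∀ x, ∃ j, x ∈ interior (K j)) (P : ℕ → (X → Y) → Prop) (h0 : ∃ f, P 0 f)
    (hstep : ∀ j f, P j f → ∃ g, P (j + 1) g ∧ EqOn g f (K j)) :
    ∃ (f : ℕ → X → Y) (F : X → Y), (∀ j, P j (f j)) ∧ (∀ j, EqOn (f (j + 1)) (f j) (K j)) ∧
      ∀ j, EqOn F (f j) (K j) := by
  classical
  obtain ⟨f, hP, hf⟩ := exists_seq_eqOn P K h0 hstep
  choose J hJ using hcov
  refine ⟨f, fun x => f (J x) x, hP, hf, fun j y hy => ?_⟩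
  have hy₁ : y ∈ K (J y) := interior_subset (hJ y)
  show f (J y) y = f j y
  rw [← eqOn_of_forall_eqOn_succ hmono hf (le_max_left j (J y)) hy,
    ← eqOn_of_forall_eqOn_succ hmono hf (le_max_right j (J y)) hy₁]

end

end Literature.Topology
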